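import Literature.Probability.Percolation.IsoradialTranslation
import Literature.Probability.Percolation.IsoradialExponentUniversality
import HarnessLib

/-!
# Universality of the alternating arm exponents for embeddings in arbitrary position
# (Grimmett–Manolescu 2014: §8.1, Prop. (exp_transport) ⟹ §3, Theorem (Universality) (a), un-centred)

Grimmett–Manolescu (*Bond percolation on isoradial graphs: criticality and universality*,
PTRF 159 (2014) 273–327 = arXiv:1204.0505) deduce the universality of the arm exponents
`ρ_{2j}` across the class `𝒢` (§3, Theorem (Universality) (a)) from the comparison
Proposition (exp_transport) of §8.1 ("Part (a) of Theorem (Universality) is an immediate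
consequence"), whose constants are uniform in the centre: "for `N ≥ N₀`, `n ≥ c₀N₀`,
`G ∈ 𝒢(ε, I)`, and any vertex `u` of `G^◇`". The tree holds Prop. 8.1 as the named facts
`GrimmettManolescu2014_armComparability_one_two` (`k ∈ {1, 2}`) and
`GrimmettManolescu2014_altArmComparability` (`k = 2j ≥ 4`), for graphs on types in `Type` drawn
**with a vertex or a face centre at the origin**, and `IsoradialExponentUniversality` proves
from them the *centred* form of the deduction (`gm_universality_altArms_centred`,
`gm_universality_arms_one_centred`: target `G` and witness `G₀` both centred), listing as its
gap (i) the passage to the origin-centred events of an embedding in *arbitrary* position — the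
form of the tree's per-graph facts `gm_universality_arms` (`Isoradial`) and of the corrected
statement `gm_universality_altArms` (recorded in the module docstring of
`IsoradialArmUniversality`), whose events `embAltArmEvent j r₀ R` are centred at `0 ∈ ℂ`
whether or not `0` is a vertex.

**This file closes gap (i)**, for graphs on types in `Type`:

* `gm_universality_altArms_of_armComparability` — assuming the two facts, the body of the
  corrected statement `gm_universality_altArms` verbatim (no centring hypothesis on `G` or on
  the witness `G₀`; alternating events `embAltArmEvent`; printed square-grid property
  `HasSquareGridPropertyGM` at `G` and at `G₀`), for `V F : Type`;
* `gm_universality_arms_one_of_armComparability_one_two` — assuming only the `k ∈ {1, 2}` fact,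
  the `j = 1` slice of the vendored fact `gm_universality_arms` on the printed class, for
  `V F : Type`, again without centring (for two arms the H21 event
  `embArmEvent (alternatingColours 1)` *is* the alternating event,
  `RhombicEmbedding.embAltArmEvent_one_eq`). For `j ≥ 2` the H21 event is not the source's
  `A_{2j}` (discrepancy D1, `IsoradialArmUniversality` / `IsoradialPrintedArms`) and nothing is
  claimed for it.

The two ingredients beyond `IsoradialExponentUniversality`:
1. **Un-centring** (`altArm_comparable_uncentred`): translate the embedding by `-z(v₀)` for a
   vertex `v₀` (`RhombicEmbedding.translate`, `IsoradialTranslation`: the class `𝒢(ε, I)` and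
   the measure are invariant, `v₀` lands at the origin), apply Prop. 8.1 to the translate, and
   come back to the origin-centred events of `G` by the change-of-centre sandwich of
   `IsoradialTranslation` (`real_embAltArmEvent_le_translate`, `real_translate_embAltArmEvent_le`:
   moving the centre by `‖a‖_∞ ≤ d` costs a change of both radii by `d`). Result: for
   `r ≥ N₀ + d`, eventually in `R`,
   `c₁ P_{ℤ²}[A_{2j}(r - d, R + d)] ≤ P_G[A_{2j}(r, R)] ≤ c₂ P_{ℤ²}[A_{2j}(r + d, R - d)]`,
   `d = ⌈‖z(v₀)‖_∞⌉` — the formal content of "any vertex `u` of `G^◇`" with "for `n > N`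
   sufficiently large" (§8.1).
2. **The analytic step with shifted radii** (`exists_hasDecayExponent_of_sandwich`, on top of
   `HasDecayExponent.comp_add/comp_sub/const_mul/of_le_le` of `CorrelationDecayProofs`): a
   sandwich `κ₁ P₀(r - D, R + D) ≤ P(r, R) ≤ κ₂ P₀(r + D, R - D)`, eventually in `R` for every
   large `r`, transports "exponent `α` for every large inner radius" from `P₀` to `P`. Because
   the two bounds are now *different* sequences, the zero-tolerant comparison
   `HasDecayExponent.of_nonneg_comparable` of the centred file does not apply as such; instead:
   if some `P₀(r⋆, ·)` is positive from `R = r⋆` on, monotonicity in the inner radius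
   (`embAltArmProb_inner_mono`) makes both bounds positive above `r⋆ + D` and the squeeze
   applies; otherwise all `P₀(r, ·)`, `r ≥ r₁`, vanish eventually (antitonicity in `R`,
   `embAltArmProb_outer_anti`), `α = 0` under the convention `Real.log 0 = 0` of
   `HasDecayExponent` (`HasDecayExponent.of_eventually_eq_zero`), and `P(r, ·)` vanishes
   eventually as well. No positivity of arm probabilities is used.
The engine `exists_hasDecayExponent_altArm_of_comparability` combines 1–2 with any Prop.-8.1
package for a given `j` (`altArm_comparability_one`, `altArm_comparability` read the packages
off the two facts); the displayed theorems feed it.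

Status. Everything here is proved; the Prop.-8.1 facts enter as hypotheses `(h12 : …) (h4 : …)`
(existing named facts; their own proof, §§5–8, is not in the tree). Remaining gap (ii) of
`IsoradialExponentUniversality` (universes: the per-graph facts are polymorphic in `V, F`, the
facts are vendored over `Type`) is untouched; the corrected named fact `gm_universality_altArms`
is not declared here (a proving seat may not add an unproved named fact) — when it is, the first
theorem is its reduction to Prop. 8.1 for graphs in `Type`. Written by the `provefact` seat of
`gm_universality_arms` (verdict: misstated, D1/D2, see `IsoradialArmUniversality`) as the
source's own proof line applied to the corrected statement.

## References

* G. R. Grimmett, I. Manolescu, *Bond percolation on isoradial graphs: criticality and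
  universality*, Probab. Theory Related Fields 159 (2014) 273–327, arXiv:1204.0505: §3
  (arm events `A_σ^u(N, n)`, Theorem (Universality) (a)), §4.2 (BAP(ε), SGP(I), `𝒢(ε, I)`),
  §8.1 (Proposition (exp_transport); "Part (a) of Theorem (Universality) is an immediate
  consequence"; "for `n > N` sufficiently large"), §8.2 (Proposition (exp_equiv)).
* G. R. Grimmett, *Percolation*, 2nd ed., Springer 1999, §9.1 (exponents as log-ratio limits).
-/

noncomputable section

open MeasureTheory Filter Topology

namespace Literature.Probability.Percolation

open LatticeModels Percolation

/-! ### Log-ratio exponents of eventually vanishing sequences (junk-value bookkeeping) -/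

/-- With Lean's convention `Real.log 0 = 0`, an eventually vanishing sequence has decay exponent
`0` in the sense of `HasDecayExponent` (bookkeeping for the degenerate case of the transport
argument below; genuine arm probabilities are positive). [folklore] -/
theorem _root_.Literature.Probability.LatticeModels.HasDecayExponent.of_eventually_eq_zero
    {u : ℕ → ℝ} (h : ∀ᶠ n in atTop, u n = 0) : HasDecayExponent u 0 := by
  unfold HasDecayExponent
  rw [neg_zero]
  refine tendsto_const_nhds.congr' ?_
  filter_upwards [h] with n hn
  rw [hn, Real.log_zero, zero_div]

/-! ### The analytic step: exponents pass through two-sided comparisons with bounded shifts of both radii -/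

/-- **Transport of the exponent of a two-radius family along a shifted sandwich.** Let
`p, p₀ : ℕ → ℕ → ℝ` be nonnegative (inner radius, outer radius ↦ probability), `p₀` antitone in
the outer and monotone in the inner radius (on `r ≤ R`), and suppose that for every large inner
radius `r`, eventually in `R`, `κ₁ p₀ (r - D) (R + D) ≤ p r R ≤ κ₂ p₀ (r + D) (R - D)` with
`κ₁, κ₂ > 0`. If `R ↦ p₀ r R` has log-ratio exponent `α` for every `r ≥ r₁`, then so has
`R ↦ p r R` for every large `r`. If some `R ↦ p₀ r⋆ R` (`r⋆ ≥ r₁`) is positive for all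
`R ≥ r⋆`, this is the squeeze `HasDecayExponent.of_le_le` above `r⋆ + D` (shifts of the scale
by `± D` and constant factors do not change log-ratio limits: `comp_add`, `comp_sub`,
`const_mul`); otherwise every `R ↦ p₀ r R`, `r ≥ r₁`, vanishes eventually (antitonicity), so
`α = 0` by the convention `log 0 = 0`, and the upper bound makes `R ↦ p r R` vanish eventually
too. This is the last, purely analytic, step of Grimmett–Manolescu's deduction of Theorem
(Universality) (a) from Proposition (exp_transport) ("Part (a) of Theorem (Universality) is an
immediate consequence", §8.1), in the tree's rendering of "exponent exists" and without any
positivity input. [cite: GrimmettManolescu2014Isoradial, §8.1 (Prop. (exp_transport) ⟹ Thm. (Universality) (a)); Grimmett 1999, §9.1] -/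
theorem exists_hasDecayExponent_of_sandwich {p p₀ : ℕ → ℕ → ℝ} {α κ₁ κ₂ : ℝ} {D r₁ r₂ : ℕ}
    (hκ₁ : 0 < κ₁) (hκ₂ : 0 < κ₂) (hp : ∀ r R, 0 ≤ p r R) (hp₀ : ∀ r R, 0 ≤ p₀ r R)
    (hanti : ∀ r R' R, r ≤ R' → R' ≤ R → p₀ r R ≤ p₀ r R')
    (hmono : ∀ r r' R, r ≤ r' → r' ≤ R → p₀ r R ≤ p₀ r' R)
    (hyp : ∀ r ≥ r₁, HasDecayExponent (fun R => p₀ r R) α)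
    (hsand : ∀ r ≥ r₂, ∀ᶠ R in atTop,
      κ₁ * p₀ (r - D) (R + D) ≤ p r R ∧ p r R ≤ κ₂ * p₀ (r + D) (R - D)) :
    ∃ r₃ : ℕ, ∀ r ≥ r₃, HasDecayExponent (fun R => p r R) α := by
  by_cases hA : ∃ rs, r₁ ≤ rs ∧ ∀ R, rs ≤ R → 0 < p₀ rs R
  · -- some inner radius with positive probabilities at all larger outer radii: squeeze
    obtain ⟨rs, hrs₁, hpos⟩ := hA
    refine ⟨max r₂ (rs + D), fun r hr => ?_⟩
    have hr₂ : r₂ ≤ r := le_of_max_le_left hr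
    have hrsD : rs + D ≤ r := le_of_max_le_right hr
    have hlow_pos : ∀ᶠ R in atTop, 0 < p₀ (r - D) (R + D) := by
      filter_upwards [eventually_ge_atTop r] with R hR
      exact (hpos (R + D) (by omega)).trans_le (hmono rs (r - D) (R + D) (by omega) (by omega))
    have hup_pos : ∀ᶠ R in atTop, 0 < p₀ (r + D) (R - D) := by
      filter_upwards [eventually_ge_atTop (r + D + D)] with R hR
      exact (hpos (R - D) (by omega)).trans_le (hmono rs (r + D) (R - D) (by omega) (by omega))
    have ha : HasDecayExponent (fun R => κ₁ * p₀ (r - D) (R + D)) α :=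
      ((hyp (r - D) (by omega)).comp_add D).const_mul hκ₁ (hlow_pos.mono fun R h => h.ne')
    have hb : HasDecayExponent (fun R => κ₂ * p₀ (r + D) (R - D)) α :=
      ((hyp (r + D) (by omega)).comp_sub D).const_mul hκ₂ (hup_pos.mono fun R h => h.ne')
    exact ha.of_le_le hb (hlow_pos.mono fun R h => mul_pos hκ₁ h)
      ((hsand r hr₂).mono fun R h => h.1) ((hsand r hr₂).mono fun R h => h.2)
  · -- otherwise all the sequences `p₀ r ·`, `r ≥ r₁`, vanish eventually, and `α = 0`
    push Not at hA
    have hzero : ∀ s, r₁ ≤ s → ∀ᶠ R in atTop, p₀ s R = 0 := by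
      intro s hs
      obtain ⟨R₀, hR₀, hle⟩ := hA s hs
      filter_upwards [eventually_ge_atTop R₀] with R hR
      exact le_antisymm ((hanti s R₀ R hR₀ hR).trans hle) (hp₀ s R)
    have hα : α = 0 :=
      (hyp r₁ le_rfl).unique (HasDecayExponent.of_eventually_eq_zero (hzero r₁ le_rfl))
    subst hα
    refine ⟨max r₁ r₂, fun r hr => ?_⟩
    have hr₁ : r₁ ≤ r := le_of_max_le_left hr
    have hr₂ : r₂ ≤ r := le_of_max_le_right hr
    refine HasDecayExponent.of_eventually_eq_zero ?_
    have h0 : ∀ᶠ R in atTop, p₀ (r + D) (R - D) = 0 :=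
      (tendsto_sub_atTop_nat D).eventually (hzero (r + D) (by omega))
    filter_upwards [hsand r hr₂, h0] with R hRs hR0
    have h2 := hRs.2
    rw [hR0, mul_zero] at h2
    exact le_antisymm h2 (hp r R)

/-! ### Proposition (exp_transport) for all alternating events, from the two named facts -/

/-- **Prop. 8.1 for the alternating two-arm event `embAltArmEvent 1`** (`k = 2`), read off the
named fact `GrimmettManolescu2014_armComparability_one_two`, which states it for
`embArmProb (alternatingColours 1)` — the probability of the H21 event
`embArmEvent (alternatingColours 1)`, equal to `embAltArmEvent 1` by
`RhombicEmbedding.embAltArmEvent_one_eq`.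
[cite: GrimmettManolescu2014Isoradial, §8.1 Prop. (exp_transport), k = 2] -/
theorem altArm_comparability_one (h12 : GrimmettManolescu2014_armComparability_one_two)
    {ε : ℝ} (hε : 0 < ε) (I : ℕ) :
    ∃ c₁ > (0 : ℝ), ∃ c₂ > (0 : ℝ), ∃ c₀ : ℕ, 1 ≤ c₀ ∧ ∃ N₀ : ℕ,
      ∀ (V F : Type) [Countable V] [DecidableEq V] [DecidableEq F] (G : SimpleGraph V)
        [G.LocallyFinite] (emb : RhombicEmbedding G F),
        G.Preconnected → emb.IsIsoradial → emb.IsRhombicTiling → emb.HasBoundedAngles ε →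
        emb.SquareGridPropertyGM I → ((∃ v : V, emb.z v = 0) ∨ (∃ f : F, emb.c f = 0)) →
        ∀ N n : ℕ, N₀ ≤ N → c₀ * N ≤ n →
          c₁ * squareLatticeEmbedding.isoradialPercolation.real
              (squareLatticeEmbedding.embAltArmEvent 1 N n) ≤
            emb.isoradialPercolation.real (emb.embAltArmEvent 1 N n) ∧
          emb.isoradialPercolation.real (emb.embAltArmEvent 1 N n) ≤
            c₂ * squareLatticeEmbedding.isoradialPercolation.real
              (squareLatticeEmbedding.embAltArmEvent 1 N n) := by
  obtain ⟨c₁, hc₁, c₂, hc₂, c₀, hc₀, N₀, H⟩ := h12.twoArm hε I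
  refine ⟨c₁, hc₁, c₂, hc₂, c₀, hc₀, N₀, ?_⟩
  intro V F _ _ _ G _ emb hconn hiso hrh hbap hsgp h0 N n hN hn
  have h := H V F G emb hconn hiso hrh hbap hsgp h0 N n hN hn
  simp only [RhombicEmbedding.embArmProb, ← RhombicEmbedding.embAltArmEvent_one_eq] at h
  exact h

/-- **Grimmett–Manolescu's Prop. 8.1 for the alternating `2j`-arm events, all `j ≥ 1`**, read
off the two named facts of the tree: `GrimmettManolescu2014_armComparability_one_two` (`k = 2`,
`altArm_comparability_one`) and `GrimmettManolescu2014_altArmComparability` (`k = 2j ≥ 4`). For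
`ε > 0`, `I`, `j ≥ 1` there are `c₁, c₂ > 0`, `c₀ ≥ 1`, `N₀` such that for every graph of
`𝒢(ε, I)` on types in `Type` with a vertex or a face centre at the origin and all `N ≥ N₀`,
`n ≥ c₀ N`, `c₁ P_{ℤ²}[A_{2j}(N, n)] ≤ P_G[A_{2j}(N, n)] ≤ c₂ P_{ℤ²}[A_{2j}(N, n)]`.
[cite: GrimmettManolescu2014Isoradial, §8.1 Prop. (exp_transport), k ∈ {2, 4, 6, …}] -/
theorem altArm_comparability (h12 : GrimmettManolescu2014_armComparability_one_two)
    (h4 : GrimmettManolescu2014_altArmComparability) {ε : ℝ} (hε : 0 < ε) (I : ℕ) {j : ℕ}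
    (hj : 1 ≤ j) :
    ∃ c₁ > (0 : ℝ), ∃ c₂ > (0 : ℝ), ∃ c₀ : ℕ, 1 ≤ c₀ ∧ ∃ N₀ : ℕ,
      ∀ (V F : Type) [Countable V] [DecidableEq V] [DecidableEq F] (G : SimpleGraph V)
        [G.LocallyFinite] (emb : RhombicEmbedding G F),
        G.Preconnected → emb.IsIsoradial → emb.IsRhombicTiling → emb.HasBoundedAngles ε →
        emb.SquareGridPropertyGM I → ((∃ v : V, emb.z v = 0) ∨ (∃ f : F, emb.c f = 0)) →
        ∀ N n : ℕ, N₀ ≤ N → c₀ * N ≤ n →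
          c₁ * squareLatticeEmbedding.isoradialPercolation.real
              (squareLatticeEmbedding.embAltArmEvent j N n) ≤
            emb.isoradialPercolation.real (emb.embAltArmEvent j N n) ∧
          emb.isoradialPercolation.real (emb.embAltArmEvent j N n) ≤
            c₂ * squareLatticeEmbedding.isoradialPercolation.real
              (squareLatticeEmbedding.embAltArmEvent j N n) := by
  rcases Nat.lt_or_ge j 2 with hj2 | hj2
  · obtain rfl : j = 1 := by omega
    exact altArm_comparability_one h12 hε I
  · exact h4 ε hε I j hj2

/-! ### Comparison with `ℤ²` around an arbitrary centre -/

/-- **Prop. 8.1 for origin-centred events of a graph in arbitrary position.** Fix the constants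
`c₁, c₂, c₀, N₀` of Prop. (exp_transport) for `𝒢(ε, I)` and the alternating `2j`-arm events
(hypothesis `H`, the shape of `altArm_comparability`). For `G ∈ 𝒢(ε, I)` drawn anywhere in the
plane (the origin need not be a vertex or a face centre) there is a shift `d` — the rounded-up
sup norm of the position of some vertex `v₀` — such that for every inner radius `r ≥ N₀ + d`,
eventually in the outer radius `R`,
`c₁ P_{ℤ²}[A_{2j}(r - d, R + d)] ≤ P_G[A_{2j}(r, R)] ≤ c₂ P_{ℤ²}[A_{2j}(r + d, R - d)]`:
translate the embedding by `-z(v₀)` (`RhombicEmbedding.translate`, `IsoradialTranslation`: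
the class and the measure are invariant), apply `H` to the translate, and compare its arm
events (centred at `v₀`) with the origin-centred ones of `G` by the change-of-centre sandwich
(`real_embAltArmEvent_le_translate`, `real_translate_embAltArmEvent_le`). This is how "for any
vertex `u` of `G^◇`" in Prop. (exp_transport) serves events centred at an arbitrary point.
[cite: GrimmettManolescu2014Isoradial, §8.1 Prop. (exp_transport) (uniformly in the centre u ∈ G^◇)] -/
theorem altArm_comparable_uncentred {ε : ℝ} {I j : ℕ} {c₁ c₂ : ℝ} {c₀ N₀ : ℕ}
    (H : ∀ (V F : Type) [Countable V] [DecidableEq V] [DecidableEq F] (G : SimpleGraph V)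
        [G.LocallyFinite] (emb : RhombicEmbedding G F),
        G.Preconnected → emb.IsIsoradial → emb.IsRhombicTiling → emb.HasBoundedAngles ε →
        emb.SquareGridPropertyGM I → ((∃ v : V, emb.z v = 0) ∨ (∃ f : F, emb.c f = 0)) →
        ∀ N n : ℕ, N₀ ≤ N → c₀ * N ≤ n →
          c₁ * squareLatticeEmbedding.isoradialPercolation.real
              (squareLatticeEmbedding.embAltArmEvent j N n) ≤
            emb.isoradialPercolation.real (emb.embAltArmEvent j N n) ∧
          emb.isoradialPercolation.real (emb.embAltArmEvent j N n) ≤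
            c₂ * squareLatticeEmbedding.isoradialPercolation.real
              (squareLatticeEmbedding.embAltArmEvent j N n))
    {V F : Type} [Countable V] [DecidableEq V] [DecidableEq F] (G : SimpleGraph V)
    [G.LocallyFinite] (emb : RhombicEmbedding G F) (hconn : G.Preconnected)
    (hiso : emb.IsIsoradial) (hrh : emb.IsRhombicTiling) (hbap : emb.HasBoundedAngles ε)
    (hsgp : emb.SquareGridPropertyGM I) :
    ∃ d : ℕ, ∀ r : ℕ, N₀ + d ≤ r → ∀ᶠ R : ℕ in atTop,
      c₁ * squareLatticeEmbedding.isoradialPercolation.real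
          (squareLatticeEmbedding.embAltArmEvent j (r - d) (R + d)) ≤
        emb.isoradialPercolation.real (emb.embAltArmEvent j r R) ∧
      emb.isoradialPercolation.real (emb.embAltArmEvent j r R) ≤
        c₂ * squareLatticeEmbedding.isoradialPercolation.real
          (squareLatticeEmbedding.embAltArmEvent j (r + d) (R - d)) := by
  -- a vertex `v₀` of `G` (the rhombi cover the plane), moved to the origin by `translate (-z v₀)`
  obtain ⟨v₀⟩ := hrh.nonempty
  obtain ⟨d, hd⟩ : ∃ d : ℕ, (-emb.z v₀).boxNorm ≤ d := ⟨⌈(-emb.z v₀).boxNorm⌉₊, Nat.le_ceil _⟩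
  refine ⟨d, fun r hr => ?_⟩
  have h0 : (∃ v : V, (emb.translate (-emb.z v₀)).z v = 0) ∨
      (∃ f : F, (emb.translate (-emb.z v₀)).c f = 0) :=
    Or.inl ⟨v₀, emb.translate_z_self v₀⟩
  have Hc := H V F G (emb.translate (-emb.z v₀)) hconn hiso.translate hrh.translate hbap.translate
    ((RhombicEmbedding.squareGridPropertyGM_translate_iff emb _ I).2 hsgp) h0
  rw [RhombicEmbedding.isoradialPercolation_translate] at Hc
  obtain ⟨K, hK⟩ : ∃ K : ℕ, K = c₀ * (r + d) := ⟨_, rfl⟩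
  have hK' : c₀ * (r - d) ≤ K := hK ▸ Nat.mul_le_mul_left c₀ (by omega)
  filter_upwards [eventually_ge_atTop (K + r + 2 * d)] with R hR
  constructor
  · -- `c₁ Q(r - d, R + d) ≤ P_{-z v₀}(r - d, R + d) ≤ P(r, R)`
    have h1 := (Hc (r - d) (R + d) (by omega) (by omega)).1
    have h2 := emb.real_translate_embAltArmEvent_le hiso j hd (r := r - d) (R := R + d)
      (by omega)
    rw [Nat.sub_add_cancel (by omega : d ≤ r), Nat.add_sub_cancel] at h2
    exact h1.trans h2
  · -- `P(r, R) ≤ P_{-z v₀}(r + d, R - d) ≤ c₂ Q(r + d, R - d)`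
    have h2 := (Hc (r + d) (R - d) (by omega) (by omega)).2
    exact (emb.real_embAltArmEvent_le_translate hiso j hd (r := r) (R := R) (by omega)).trans h2

/-! ### The transport engine: exponents of the alternating events from any Prop.-8.1 package -/

/-- **Universality of the exponent of `A_{2j}` from a Prop.-8.1 comparison package for that
`j`.** Suppose that for every `ε > 0` and `I` the alternating `2j`-arm probabilities of the
graphs of `𝒢(ε, I)` (types in `Type`, a vertex or face centre at the origin) are two-sided
comparable with those of `ℤ²` in the scope `N ≥ N₀`, `n ≥ c₀ N` (hypothesis `hcmp`, the shape
of `altArm_comparability`). Then for `G ∈ 𝒢` (any position in the plane) and a witness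
`G₀ ∈ 𝒢` whose events `A_{2j}(r₀, ·)` have exponent `α` for every large `r₀`, the events of
`G` have exponent `α` for every large `r₀`. Proof: `G ∈ 𝒢(ε, I)`, `G₀ ∈ 𝒢(ε₀, I₀)`; the
package for each class compares the origin-centred arm probabilities of `G`, resp. `G₀`, with
those of `ℤ²` up to constants and a bounded shift of both radii (`altArm_comparable_uncentred`,
re-centring at a vertex); eliminating `ℤ²` gives
`κ₁ P_{G₀}[A(r - D, R + D)] ≤ P_G[A(r, R)] ≤ κ₂ P_{G₀}[A(r + D, R - D)]` eventually in `R`, for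
every large `r`, and `exists_hasDecayExponent_of_sandwich` (with the monotonicity of the arm
probabilities in the radii, `IsoradialArmComparisonProofs`) transports the exponent.
[cite: GrimmettManolescu2014Isoradial, §8.1 ("Part (a) of Theorem (Universality) is an immediate consequence")] -/
theorem exists_hasDecayExponent_altArm_of_comparability (j : ℕ)
    (hcmp : ∀ (ε : ℝ), 0 < ε → ∀ (I : ℕ),
      ∃ c₁ > (0 : ℝ), ∃ c₂ > (0 : ℝ), ∃ c₀ : ℕ, 1 ≤ c₀ ∧ ∃ N₀ : ℕ,
        ∀ (V F : Type) [Countable V] [DecidableEq V] [DecidableEq F] (G : SimpleGraph V)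
          [G.LocallyFinite] (emb : RhombicEmbedding G F),
          G.Preconnected → emb.IsIsoradial → emb.IsRhombicTiling → emb.HasBoundedAngles ε →
          emb.SquareGridPropertyGM I → ((∃ v : V, emb.z v = 0) ∨ (∃ f : F, emb.c f = 0)) →
          ∀ N n : ℕ, N₀ ≤ N → c₀ * N ≤ n →
            c₁ * squareLatticeEmbedding.isoradialPercolation.real
                (squareLatticeEmbedding.embAltArmEvent j N n) ≤
              emb.isoradialPercolation.real (emb.embAltArmEvent j N n) ∧
            emb.isoradialPercolation.real (emb.embAltArmEvent j N n) ≤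
              c₂ * squareLatticeEmbedding.isoradialPercolation.real
                (squareLatticeEmbedding.embAltArmEvent j N n))
    {V F : Type} [Countable V] [DecidableEq V] [DecidableEq F] (G : SimpleGraph V)
    [G.LocallyFinite] (emb : RhombicEmbedding G F) {ε : ℝ}
    (hconn : G.Preconnected) (hiso : emb.IsIsoradial) (hrh : emb.IsRhombicTiling) (hε : 0 < ε)
    (hbap : emb.HasBoundedAngles ε) (hsgp : emb.HasSquareGridPropertyGM) {α : ℝ}
    (h : ∃ (V₀ F₀ : Type) (_ : Countable V₀) (_ : DecidableEq V₀) (_ : DecidableEq F₀)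
      (G₀ : SimpleGraph V₀) (_ : G₀.LocallyFinite) (emb₀ : RhombicEmbedding G₀ F₀) (ε₀ : ℝ),
      G₀.Preconnected ∧ emb₀.IsIsoradial ∧ emb₀.IsRhombicTiling ∧ 0 < ε₀ ∧
        emb₀.HasBoundedAngles ε₀ ∧ emb₀.HasSquareGridPropertyGM ∧
        ∃ r₁ : ℕ, ∀ r₀ ≥ r₁, HasDecayExponent
          (fun R => emb₀.isoradialPercolation.real (emb₀.embAltArmEvent j r₀ R)) α) :
    ∃ r₁ : ℕ, ∀ r₀ ≥ r₁, HasDecayExponent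
      (fun R => emb.isoradialPercolation.real (emb.embAltArmEvent j r₀ R)) α := by
  obtain ⟨V₀, F₀, _, _, _, G₀, _, emb₀, ε₀, hconn₀, hiso₀, hrh₀, hε₀, hbap₀, ⟨I₀, hsgp₀⟩, r₁,
    hyp⟩ := h
  obtain ⟨I, hsgpI⟩ := hsgp
  -- Prop. 8.1 for the class of `G` and for the class of `G₀`
  obtain ⟨c₁, hc₁, c₂, hc₂, c₀, -, N₀, H⟩ := hcmp ε hε I
  obtain ⟨c₁', hc₁', c₂', hc₂', c₀', -, N₀', H'⟩ := hcmp ε₀ hε₀ I₀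
  -- two-sided comparisons with `ℤ²`, around the origin, for `G` and for `G₀`
  obtain ⟨d, hd⟩ := altArm_comparable_uncentred H G emb hconn hiso hrh hbap hsgpI
  obtain ⟨d₀, hd₀⟩ := altArm_comparable_uncentred H' G₀ emb₀ hconn₀ hiso₀ hrh₀ hbap₀ hsgp₀
  -- the analytic step, with `D = d + d₀`, `κ₁ = c₁ / c₂'`, `κ₂ = c₂ / c₁'`
  refine exists_hasDecayExponent_of_sandwich
    (p := fun r R => emb.isoradialPercolation.real (emb.embAltArmEvent j r R))
    (p₀ := fun r R => emb₀.isoradialPercolation.real (emb₀.embAltArmEvent j r R))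
    (κ₁ := c₁ / c₂') (κ₂ := c₂ / c₁') (D := d + d₀) (r₁ := r₁)
    (r₂ := N₀ + N₀' + 2 * (d + d₀)) (div_pos hc₁ hc₂') (div_pos hc₂ hc₁')
    (fun r R => measureReal_nonneg) (fun r R => measureReal_nonneg)
    (fun r R' R h1 h2 => emb₀.embAltArmProb_outer_anti hiso₀ j h1 h2)
    (fun r r' R h1 h2 => emb₀.embAltArmProb_inner_mono hiso₀ j h1 h2) hyp ?_
  intro r hr
  have hG := hd r (by omega)
  -- `G₀` at inner radius `r + d + d₀`, read at outer radius `R - d - d₀`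
  have hup : ∀ᶠ R : ℕ in atTop,
      c₁' * squareLatticeEmbedding.isoradialPercolation.real
          (squareLatticeEmbedding.embAltArmEvent j (r + d) (R - d)) ≤
        emb₀.isoradialPercolation.real
          (emb₀.embAltArmEvent j (r + (d + d₀)) (R - (d + d₀))) := by
    have h' := (tendsto_sub_atTop_nat (d + d₀)).eventually (hd₀ (r + (d + d₀)) (by omega))
    filter_upwards [h', eventually_ge_atTop (d + d₀)] with R hR hRge
    have h1 := hR.1
    have e1 : r + (d + d₀) - d₀ = r + d := by omega
    have e2 : R - (d + d₀) + d₀ = R - d := by omega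
    rw [e1, e2] at h1
    exact h1
  -- `G₀` at inner radius `r - d - d₀`, read at outer radius `R + d + d₀`
  have hlow : ∀ᶠ R : ℕ in atTop,
      emb₀.isoradialPercolation.real (emb₀.embAltArmEvent j (r - (d + d₀)) (R + (d + d₀))) ≤
        c₂' * squareLatticeEmbedding.isoradialPercolation.real
          (squareLatticeEmbedding.embAltArmEvent j (r - d) (R + d)) := by
    have h' := (tendsto_add_atTop_nat (d + d₀)).eventually (hd₀ (r - (d + d₀)) (by omega))
    filter_upwards [h'] with R hR
    have h2 := hR.2
    have e1 : r - (d + d₀) + d₀ = r - d := by omega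
    have e2 : R + (d + d₀) - d₀ = R + d := by omega
    rw [e1, e2] at h2
    exact h2
  filter_upwards [hG, hup, hlow] with R hRG hRup hRlow
  constructor
  · calc c₁ / c₂' * emb₀.isoradialPercolation.real
          (emb₀.embAltArmEvent j (r - (d + d₀)) (R + (d + d₀)))
        ≤ c₁ / c₂' * (c₂' * squareLatticeEmbedding.isoradialPercolation.real
            (squareLatticeEmbedding.embAltArmEvent j (r - d) (R + d))) :=
          mul_le_mul_of_nonneg_left hRlow (div_pos hc₁ hc₂').le
      _ = c₁ * squareLatticeEmbedding.isoradialPercolation.real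
            (squareLatticeEmbedding.embAltArmEvent j (r - d) (R + d)) := by
          field_simp
      _ ≤ emb.isoradialPercolation.real (emb.embAltArmEvent j r R) := hRG.1
  · calc emb.isoradialPercolation.real (emb.embAltArmEvent j r R)
        ≤ c₂ * squareLatticeEmbedding.isoradialPercolation.real
            (squareLatticeEmbedding.embAltArmEvent j (r + d) (R - d)) := hRG.2
      _ ≤ c₂ * (emb₀.isoradialPercolation.real
            (emb₀.embAltArmEvent j (r + (d + d₀)) (R - (d + d₀))) / c₁') := by
          refine mul_le_mul_of_nonneg_left ?_ hc₂.le
          rw [le_div_iff₀ hc₁', mul_comm]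
          exact hRup
      _ = c₂ / c₁' * emb₀.isoradialPercolation.real
            (emb₀.embAltArmEvent j (r + (d + d₀)) (R - (d + d₀))) := by ring

/-! ### The corrected universality statement, and the `j = 1` slice of the vendored fact, from Proposition (exp_transport) -/

/-- **§8.1 ⟹ §3 Theorem (Universality) (a), `π = ρ_{2j}`: the corrected transcription of
Grimmett–Manolescu's universality of the alternating arm exponents follows from their comparison
Proposition (exp_transport), for graphs on types in `Type`.** Assume the tree's two named facts
transcribing Prop. 8.1 (`GrimmettManolescu2014_armComparability_one_two`, `k ∈ {1, 2}`;
`GrimmettManolescu2014_altArmComparability`, `k = 2j ≥ 4`). Let `G` be countable, locally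
finite, preconnected, isoradially and rhombically embedded with `HasBoundedAngles ε`, `0 < ε`,
and the printed square-grid property `HasSquareGridPropertyGM` (`G ∈ 𝒢`), and let `j ≥ 1`. If
for some `G₀ ∈ 𝒢` and every large (then fixed) inner radius `r₀` the probability of the
alternating `2j`-arm event `embAltArmEvent j r₀ R` under `P_{G₀}` is `R^{-α + o(1)}`
(`HasDecayExponent`), then the same holds for `G`, with the same `α`. The conclusion together
with the binders on `G` is, word for word, the body of the corrected statement
`gm_universality_altArms` recorded in the module docstring of `IsoradialArmUniversality`
(there for `V F : Type*`; here `V F : Type` because the facts quantify over `Type`), so that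
statement is reduced to Prop. 8.1 exactly as printed: "Part (a) of Theorem (Universality) is an
immediate consequence" (§8.1). It is `gm_universality_altArms_centred`
(`IsoradialExponentUniversality`) with both centring hypotheses removed (gap (i) of that file);
the witness's `ε₀`, `I₀` may differ from `ε`, `I`.
[cite: GrimmettManolescu2014Isoradial, §3 Theorem (Universality) (a), π = ρ_{2j}, via §8.1 Prop. (exp_transport)] -/
theorem gm_universality_altArms_of_armComparability
    (h12 : GrimmettManolescu2014_armComparability_one_two)
    (h4 : GrimmettManolescu2014_altArmComparability)
    {V F : Type} [Countable V] [DecidableEq V] [DecidableEq F] (G : SimpleGraph V)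
    [G.LocallyFinite] (emb : RhombicEmbedding G F) (ε : ℝ) :
    ∀ (_ : G.Preconnected) (_ : emb.IsIsoradial) (_ : emb.IsRhombicTiling) (_ : 0 < ε)
      (_ : emb.HasBoundedAngles ε) (_ : emb.HasSquareGridPropertyGM) (j : ℕ) (_ : 1 ≤ j)
      (α : ℝ)
      (_ : ∃ (V₀ F₀ : Type) (_ : Countable V₀) (_ : DecidableEq V₀) (_ : DecidableEq F₀)
        (G₀ : SimpleGraph V₀) (_ : G₀.LocallyFinite) (emb₀ : RhombicEmbedding G₀ F₀) (ε₀ : ℝ),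
        G₀.Preconnected ∧ emb₀.IsIsoradial ∧ emb₀.IsRhombicTiling ∧ 0 < ε₀ ∧
          emb₀.HasBoundedAngles ε₀ ∧ emb₀.HasSquareGridPropertyGM ∧
          ∃ r₁ : ℕ, ∀ r₀ ≥ r₁, HasDecayExponent
            (fun R => emb₀.isoradialPercolation.real (emb₀.embAltArmEvent j r₀ R)) α),
      ∃ r₁ : ℕ, ∀ r₀ ≥ r₁, HasDecayExponent
        (fun R => emb.isoradialPercolation.real (emb.embAltArmEvent j r₀ R)) α :=
  fun hconn hiso hrh hε hbap hsgp j hj _ h =>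
    exists_hasDecayExponent_altArm_of_comparability j
      (fun _ hε' I => altArm_comparability h12 h4 hε' I hj) G emb hconn hiso hrh hε hbap hsgp h

/-- **The `j = 1` slice of the vendored fact `gm_universality_arms`, on the printed class and
in `Type`, from Prop. 8.1 (`k = 2`) alone.** For `2j = 2` arms the H21 event
`embArmEvent (alternatingColours 1)` of `gm_universality_arms` *is* the alternating event
`embAltArmEvent 1` (`RhombicEmbedding.embAltArmEvent_one_eq`), so the transport
engine, fed with `GrimmettManolescu2014_armComparability_one_two` (`altArm_comparability_one`),
proves: for `G ∈ 𝒢` (printed square-grid property, types in `Type`), if the two-arm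
probabilities `P_{G₀}[A_2(r₀, R)]` of some `G₀ ∈ 𝒢` have exponent `α` for every large `r₀`,
then so have those of `G` — Grimmett–Manolescu's universality of `ρ_2`, i.e. the conclusion of
`gm_universality_arms.toGM_one` (`IsoradialPrintedArms`) for graphs in `Type`, here obtained
from Prop. 8.1 instead of from the (misstated) fact; it is `gm_universality_arms_one_centred`
(`IsoradialExponentUniversality`) with both centring hypotheses removed. Nothing is obtained for `j ≥ 2` in the
H21 rendering of the event (D1, module docstring of `IsoradialArmUniversality`).
[cite: GrimmettManolescu2014Isoradial, §3 Theorem (Universality) (a), π = ρ_2, via §8.1 Prop. (exp_transport) (k = 2)] -/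
theorem gm_universality_arms_one_of_armComparability_one_two
    (h12 : GrimmettManolescu2014_armComparability_one_two)
    {V F : Type} [Countable V] [DecidableEq V] [DecidableEq F] (G : SimpleGraph V)
    [G.LocallyFinite] (emb : RhombicEmbedding G F) (ε : ℝ) :
    ∀ (_ : G.Preconnected) (_ : emb.IsIsoradial) (_ : emb.IsRhombicTiling) (_ : 0 < ε)
      (_ : emb.HasBoundedAngles ε) (_ : emb.HasSquareGridPropertyGM) (α : ℝ)
      (_ : ∃ (V₀ F₀ : Type) (_ : Countable V₀) (_ : DecidableEq V₀) (_ : DecidableEq F₀)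
        (G₀ : SimpleGraph V₀) (_ : G₀.LocallyFinite) (emb₀ : RhombicEmbedding G₀ F₀) (ε₀ : ℝ),
        G₀.Preconnected ∧ emb₀.IsIsoradial ∧ emb₀.IsRhombicTiling ∧ 0 < ε₀ ∧
          emb₀.HasBoundedAngles ε₀ ∧ emb₀.HasSquareGridPropertyGM ∧
          ∃ r₁ : ℕ, ∀ r₀ ≥ r₁, HasDecayExponent (fun R => emb₀.isoradialPercolation.real
            (emb₀.embArmEvent (alternatingColours 1) r₀ R)) α),
      ∃ r₁ : ℕ, ∀ r₀ ≥ r₁, HasDecayExponent (fun R => emb.isoradialPercolation.real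
        (emb.embArmEvent (alternatingColours 1) r₀ R)) α := by
  intro hconn hiso hrh hε hbap hsgp α h
  simp_rw [← RhombicEmbedding.embAltArmEvent_one_eq] at h ⊢
  exact exists_hasDecayExponent_altArm_of_comparability 1
    (fun _ hε' I => altArm_comparability_one h12 hε' I) G emb hconn hiso hrh hε hbap hsgp h

end Literature.Probability.Percolation

end
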